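import Mathlib
import HarnessLib
import Summits.Ventures.LatticeQCDFlow.StatementCrossCut
import Summits.Ventures.LatticeQCDFlow.Scaling.U1CrossCutFloorAllT
import Summits.Ventures.LatticeQCDFlow.Scaling.SUNCrossCutFloor
import Summits.Ventures.LatticeQCDFlow.Scaling.DefectVarianceFloor
import Summits.Ventures.LatticeQCDFlow.Scaling.ClusteringFloorTwoClasses
import Summits.Ventures.LatticeQCDFlow.Scaling.UNCrossCutFloor

/-!
# Venture statement — LatticeQCDFlow — DRAFT, Parts S15–S19: THE CROSS-CUT FLOOR (U′) FOR EVERY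
# CUT WIDTH AND THE CLUSTERING FLOOR (U″) AT STRONG COUPLING FOR `U(1)`, `SU(N)`, `U(N)`; THE
# DEFECT SPECIFIC-HEAT FLOOR; (U′)_R ⇔ (U″) ALONG EVERY AXIS AT EVERY `β > 0`
# (lean-1 rows 30, GEN-9 … GEN-12) — STAGED FOR THE THAW-DAY LEAD, NOT FILED

HONEST FRAMING: exact (Metropolis-corrected) sampling algorithms for lattice gauge theory;
figures of merit are autocorrelation/cost numbers at stated couplings and volumes; no
continuum-physics claim.

This file CONTINUES `StatementCrossCut.lean` (Part S14) of the venture's `Statement.lean` DRAFT.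
`Statement*.lean` is FROZEN through Mon 2026-08-25T09:00Z (LEAD LINE 234 (iv)); this draft is
STAGED in `HOME/lean-1/thaw/` for the thaw-day lead and theory2 to word / trim / file — it is NOT
a proposal.  Every `Prop` is a typed statement over the landed substrate with its `_holds`
discharge next to it, and `TheoryStatementS19 := TheoryStatementS14 ∧ S15 ∧ … ∧ S19` is PROVED.

* **S15 (U′) AT STRONG COUPLING FOR EVERY CUT WIDTH `R`, `U(1)`** (lean-1 GEN-9,
  `Scaling/U1CrossCutFloorAllT.lean`): for every `d`, `i < j`, `a ∉ {i, j}` and every `R` there is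
  ONE `β₀ > 0` with `Conjectures.CrossCutCorrelatorFloor d 1 Circle u1Rep β R i j a` for every real
  `β ≠ 0`, `|β| ≤ β₀` (the leading tube `2^{-(4t+1)} β^{4t}`, `t = 2R+1`, by the slab chain).
* **S16 (U′) AT STRONG COUPLING FOR EVERY `R`, `SU(N)` (`N ≥ 2`) AND `U(N)` (`N ≥ 1`)** (lean-1
  GEN-10 `Scaling/SUNCrossCutFloor.lean`, GEN-12 `Scaling/UNCrossCutFloor.lean`): the same for the
  fundamental / defining representations (one-link data `θ = 1/(2N)`, `SU(2)`: `½`).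
* **S17 THE DEFECT SPECIFIC-HEAT FLOOR** (lean-1 GEN-11 `Scaling/DefectVarianceFloor.lean`, theory2
  item 132's (DVF)): for every compact second-countable `G`, continuous `ρ`, every `d`, `L ≥ 2`, every
  finite set `D` of plaquettes and all real `β, u` with `|β|, |u| ≤ B`:
  `e^{−8N(d−1)B} · #D/(8d(d−1)+1) · Var_Haar(Re tr ρ) ≤ Var[S_D ; (⊗Haar).tilted(−(β S_{Dᶜ} + u S_D))]`.
* **S18 (U″) AT STRONG COUPLING ALONG EVERY TRANSVERSE AXIS, `SU(N)`, `U(1)`, `U(N)`** (lean-1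
  GEN-11 `Scaling/ClusteringFloorAnyAxis.lean`, GEN-12 `Scaling/UNCrossCutFloor.lean`): for `i ≠ j`,
  `a ∉ {i, j}`: `∃ β₀ > 0, ∀ β ∈ (0, β₀], Conjectures.ClusteringFloor d N G ρ β i j a` (reflection
  positivity ⇒ log-convexity on top of (U′) at `R = 0`).
* **S19 (U′)_R ⇔ (U″) ALONG EVERY AXIS AT EVERY `β > 0`; AT MOST TWO CONJECTURES PER `(G, ρ, d, β)`**
  (lean-1 GEN-11 `Scaling/CrossCutFloorAnySeparation.lean` for transverse axes and every `R`; GEN-12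
  `Scaling/ClusteringFloorInPlane.lean` for in-plane axes, `R ≥ 1`, and
  `Scaling/ClusteringFloorTwoClasses.lean` for the symmetry classes): for every compact
  second-countable `G`, continuous `ρ`, `β > 0`, `i ≠ j`: (a) for every axis `a` and every `R ≥ 1`,
  `ClusteringFloor d N G ρ β i j a ↔ CrossCutCorrelatorFloor d N G ρ β R i j a`; (b) for a
  transverse axis also at `R = 0`; (c) for `d ≥ 3`, every such item is equivalent to one of TWO
  representatives — the transverse `ClusteringFloor … 0 1 2` (`a ∉ {i, j}`) or the in-plane
  `ClusteringFloor … 0 1 0` (`a ∈ {i, j}`).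

What is NOT claimed: any `β` beyond the unspecified `β₀` (intermediate coupling is the open content:
ONE volume-uniform floor per plane/axis); in-plane floors at strong coupling; in-plane (U′)_0 ⇒ (U″);
`d = 2` (no transverse axis exists; the in-plane equivalence S19 holds there formally); sharp
constants; every continuum statement.  Nothing numerical is asserted; no `sorry`; the only new
`def`s are the `Prop`s of record.
-/

noncomputable section

open MeasureTheory ProbabilityTheory Filter Topology Asymptotics
open Literature.MathematicalPhysics.QuantumFieldTheory
open Literature.MathematicalPhysics.QuantumLattice (u1Rep fundamentalRep unitaryFundamentalRep)

namespace Summit.Ventures.LatticeQCDFlow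

/-! ### Part S, appended — S15–S19 (lean-1 GEN-9 … GEN-12) -/

/-- **S15 ((U′) AT STRONG COUPLING FOR EVERY CUT WIDTH, COMPACT `U(1)`).**  For every `d`, `i < j`,
`a ≠ i`, `a ≠ j` and every `R`:
`∃ β₀ > 0, ∀ β ≠ 0, |β| ≤ β₀ → Conjectures.CrossCutCorrelatorFloor d 1 Circle u1Rep β R i j a`.
PROVED: `Theory2.Lattice.U1Layer.crossCutCorrelatorFloor_u1_all` (lean-1 GEN-9). -/
def S15_U1CrossCutFloorAllR : Prop :=
  ∀ (d : ℕ) (i j a : Fin d) (R : ℕ), i < j → a ≠ i → a ≠ j →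
    ∃ β₀ : ℝ, 0 < β₀ ∧ ∀ β : ℝ, β ≠ 0 → |β| ≤ β₀ →
      Conjectures.CrossCutCorrelatorFloor d 1 Circle u1Rep β R i j a

/-- S15 holds. -/
theorem S15_U1CrossCutFloorAllR_holds : S15_U1CrossCutFloorAllR :=
  fun _ _ _ _ R hij hai haj => Theory2.Lattice.U1Layer.crossCutCorrelatorFloor_u1_all hij hai haj R

/-- **S16 ((U′) AT STRONG COUPLING FOR EVERY CUT WIDTH, `SU(N)` (`N ≥ 2`) AND `U(N)` (`N ≥ 1`),
FUNDAMENTAL / DEFINING REPRESENTATION).**  For every `d`, `i < j`, `a ∉ {i, j}`, every `R`: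
`∃ β₀ > 0, ∀ β ≠ 0, |β| ≤ β₀ → Conjectures.CrossCutCorrelatorFloor d N G ρ β R i j a` with
`(G, ρ) = (SU(N), fundamentalRep)`, `N ≥ 2`, and `(U(N), unitaryFundamentalRep)`, `N ≥ 1`.
PROVED: `Theory2.GroupLayer.crossCutCorrelatorFloor_sun` (GEN-10), `…_un` (GEN-12). -/
def S16_SUNUNCrossCutFloorAllR : Prop :=
  (∀ (N d : ℕ) (i j a : Fin d) (R : ℕ), 2 ≤ N → i < j → a ≠ i → a ≠ j →
    ∃ β₀ : ℝ, 0 < β₀ ∧ ∀ β : ℝ, β ≠ 0 → |β| ≤ β₀ →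
      Conjectures.CrossCutCorrelatorFloor d N (Matrix.specialUnitaryGroup (Fin N) ℂ)
        (fundamentalRep (Fin N)) β R i j a) ∧
  (∀ (N d : ℕ) (i j a : Fin d) (R : ℕ), 1 ≤ N → i < j → a ≠ i → a ≠ j →
    ∃ β₀ : ℝ, 0 < β₀ ∧ ∀ β : ℝ, β ≠ 0 → |β| ≤ β₀ →
      Conjectures.CrossCutCorrelatorFloor d N (Matrix.unitaryGroup (Fin N) ℂ)
        (unitaryFundamentalRep (Fin N) ℂ) β R i j a)

/-- S16 holds. -/
theorem S16_SUNUNCrossCutFloorAllR_holds : S16_SUNUNCrossCutFloorAllR :=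
  ⟨fun _ _ _ _ _ R hN hij hai haj => Theory2.GroupLayer.crossCutCorrelatorFloor_sun hN hij hai haj R,
    fun _ _ _ _ _ R hN hij hai haj => Theory2.GroupLayer.crossCutCorrelatorFloor_un hN hij hai haj R⟩

/-- **S17 (THE DEFECT SPECIFIC-HEAT FLOOR — theory2 item 132's hypothesis (DVF) is a theorem).**  For
every compact second-countable `G`, continuous `ρ : G →* M_N(ℂ)`, every `d`, `L ≥ 2`, every finite set
`D` of plaquettes of `(ℤ/L)^d` and all real `β, u, B` with `|β| ≤ B`, `|u| ≤ B`:
`e^{−8N(d−1)B} · #D/(8d(d−1)+1) · Var_Haar(Re tr ρ) ≤ Var[Σ_{p∈D}(N − Re tr ρ(U_p)) ; (⊗Haar).tilted(−(β Σ_{p∉D} + u Σ_{p∈D})(N − Re tr ρ(U_p)))]`.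
PROVED: `Theory2.DefectFloor.defect_variance_floor` (lean-1 GEN-11). -/
def S17_DefectVarianceFloor : Prop :=
  ∀ (d L N : ℕ) [NeZero L] (G : Type) [Group G] [TopologicalSpace G] [IsTopologicalGroup G]
    [CompactSpace G] [MeasurableSpace G] [BorelSpace G] [SecondCountableTopology G]
    (ρ : G →* Matrix (Fin N) (Fin N) ℂ), 2 ≤ L → Continuous ρ →
    ∀ (β u B : ℝ), |β| ≤ B → |u| ≤ B → ∀ D : Finset (Plaquette d L),
      Real.exp (-(8 * N * ((d - 1 : ℕ) : ℝ) * B)) * ((D.card : ℝ) / ((8 * d * (d - 1) + 1 : ℕ) : ℝ))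
          * variance (fun g : G => (ρ g).trace.re) (haarProbability G)
        ≤ variance (fun U : GaugeConfig d L G =>
              ∑ p ∈ D, ((N : ℝ) - (ρ (plaquetteHolonomy U p.1 p.2.1.1 p.2.1.2)).trace.re))
            ((Measure.pi fun _ : Edge d L => haarProbability G).tilted fun U =>
              -(β * (∑ p ∈ Dᶜ, ((N : ℝ) - (ρ (plaquetteHolonomy U p.1 p.2.1.1 p.2.1.2)).trace.re))
                + u * (∑ p ∈ D, ((N : ℝ) - (ρ (plaquetteHolonomy U p.1 p.2.1.1 p.2.1.2)).trace.re))))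

/-- S17 holds. -/
theorem S17_DefectVarianceFloor_holds : S17_DefectVarianceFloor :=
  fun _ _ _ _ _ _ _ _ _ _ _ _ ρ hL hρ _ _ _ hβ hu D =>
    Theory2.DefectFloor.defect_variance_floor ρ hL hρ hβ hu D

/-- **S18 ((U″) AT STRONG COUPLING ALONG EVERY TRANSVERSE AXIS — `SU(N)` (`N ≥ 2`), `U(1)`, `U(N)`
(`N ≥ 1`)).**  For every `d`, `i ≠ j`, `a ≠ i`, `a ≠ j`:
`∃ β₀ > 0, ∀ β, 0 < β → β ≤ β₀ → Conjectures.ClusteringFloor d N G ρ β i j a` for the three families.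
PROVED: `Theory2.Clustering.clusteringFloor_sun_transverse`, `…_u1_transverse` (lean-1 GEN-11),
`Theory2.GroupLayer.clusteringFloor_un_transverse` (GEN-12). -/
def S18_ClusteringFloorStrongCoupling : Prop :=
  (∀ (N d : ℕ) (i j a : Fin d), 2 ≤ N → i ≠ j → a ≠ i → a ≠ j →
    ∃ β₀ : ℝ, 0 < β₀ ∧ ∀ β : ℝ, 0 < β → β ≤ β₀ →
      Conjectures.ClusteringFloor d N (Matrix.specialUnitaryGroup (Fin N) ℂ)
        (fundamentalRep (Fin N)) β i j a) ∧
  (∀ (d : ℕ) (i j a : Fin d), i ≠ j → a ≠ i → a ≠ j →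
    ∃ β₀ : ℝ, 0 < β₀ ∧ ∀ β : ℝ, 0 < β → β ≤ β₀ →
      Conjectures.ClusteringFloor d 1 Circle u1Rep β i j a) ∧
  (∀ (N d : ℕ) (i j a : Fin d), 1 ≤ N → i ≠ j → a ≠ i → a ≠ j →
    ∃ β₀ : ℝ, 0 < β₀ ∧ ∀ β : ℝ, 0 < β → β ≤ β₀ →
      Conjectures.ClusteringFloor d N (Matrix.unitaryGroup (Fin N) ℂ)
        (unitaryFundamentalRep (Fin N) ℂ) β i j a)

/-- S18 holds. -/
theorem S18_ClusteringFloorStrongCoupling_holds : S18_ClusteringFloorStrongCoupling := by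
  refine ⟨fun N d i j a hN hij hai haj => ?_, fun d i j a hij hai haj => ?_,
    fun N d i j a hN hij hai haj => Theory2.GroupLayer.clusteringFloor_un_transverse hN hij hai haj⟩
  · by_cases hd : d = 0
    · subst hd; exact i.elim0
    · haveI : NeZero d := ⟨hd⟩
      exact Theory2.Clustering.clusteringFloor_sun_transverse hN hij hai haj
  · by_cases hd : d = 0
    · subst hd; exact i.elim0
    · haveI : NeZero d := ⟨hd⟩
      exact Theory2.Clustering.clusteringFloor_u1_transverse hij hai haj

/-- **S19 ((U′)_R ⇔ (U″) ALONG EVERY AXIS AT EVERY `β > 0`; transverse axes also at `R = 0`; AT MOST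
TWO CONJECTURES).**  For every compact second-countable `G`, continuous `ρ`, `β > 0`, every `d`,
`i ≠ j` and axis `a`:
(a) for every `R ≥ 1`,
`Conjectures.ClusteringFloor d N G ρ β i j a ↔ Conjectures.CrossCutCorrelatorFloor d N G ρ β R i j a`;
(b) for a transverse axis `a ∉ {i, j}` the same at every `R` (including `R = 0`);
(c) for `d ≥ 3` and every `R ≥ 1` the item `CrossCutCorrelatorFloor d N G ρ β R i j a` is equivalent
to the transverse representative `ClusteringFloor d N G ρ β 0 1 2` (if `a ∉ {i, j}`) or to the
in-plane representative `ClusteringFloor d N G ρ β 0 1 0` (if `a ∈ {i, j}`).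
PROVED: `Theory2.Clustering.clusteringFloor_iff_crossCut_anyAxis`, `crossCut_iff_representative`
(lean-1 GEN-12), `Theory2.Clustering.clusteringFloor_iff_crossCut` (GEN-11). -/
def S19_ClusteringFloorIffCrossCut : Prop :=
  ∀ (d N : ℕ) (G : Type) [Group G] [TopologicalSpace G] [IsTopologicalGroup G] [CompactSpace G]
    [MeasurableSpace G] [BorelSpace G] [SecondCountableTopology G]
    (ρ : G →* Matrix (Fin N) (Fin N) ℂ), Continuous ρ → ∀ (β : ℝ), 0 < β →
    ∀ (i j a : Fin d), i ≠ j →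
      (∀ R : ℕ, 1 ≤ R →
        (Conjectures.ClusteringFloor d N G ρ β i j a ↔
          Conjectures.CrossCutCorrelatorFloor d N G ρ β R i j a)) ∧
      (a ≠ i → a ≠ j → ∀ R : ℕ,
        (Conjectures.ClusteringFloor d N G ρ β i j a ↔
          Conjectures.CrossCutCorrelatorFloor d N G ρ β R i j a)) ∧
      (∀ (hd : 3 ≤ d) (R : ℕ), 1 ≤ R →
        (a ≠ i ∧ a ≠ j ∧ (Conjectures.CrossCutCorrelatorFloor d N G ρ β R i j a ↔
            Conjectures.ClusteringFloor d N G ρ β ⟨0, by omega⟩ ⟨1, by omega⟩ ⟨2, by omega⟩)) ∨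
        ((a = i ∨ a = j) ∧ (Conjectures.CrossCutCorrelatorFloor d N G ρ β R i j a ↔
            Conjectures.ClusteringFloor d N G ρ β ⟨0, by omega⟩ ⟨1, by omega⟩ ⟨0, by omega⟩)))

/-- S19 holds. -/
theorem S19_ClusteringFloorIffCrossCut_holds : S19_ClusteringFloorIffCrossCut := by
  intro d N G _ _ _ _ _ _ _ ρ hρ β hβ i j a hij
  by_cases hd : d = 0
  · subst hd; exact i.elim0
  · haveI : NeZero d := ⟨hd⟩
    exact ⟨fun R hR => Theory2.Clustering.clusteringFloor_iff_crossCut_anyAxis ρ hρ hβ hij a hR,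
      fun hai haj R => Theory2.Clustering.clusteringFloor_iff_crossCut ρ hρ hβ hai haj R,
      fun hd3 R hR => Theory2.Clustering.crossCut_iff_representative ρ hd3 hρ hβ hR hij a⟩

/-- **The theory conjunction of record, extended by Parts S15–S19**:
`TheoryStatementS19 := TheoryStatementS14 ∧ S15 ∧ S16 ∧ S17 ∧ S18 ∧ S19`.  All conjuncts are
theorems in the tree (`TheoryStatementS19_holds`).  DRAFT until the operator adopts it; nothing
numerical is asserted. -/
def TheoryStatementS19 : Prop :=
  TheoryStatementS14 ∧ S15_U1CrossCutFloorAllR ∧ S16_SUNUNCrossCutFloorAllR ∧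
    S17_DefectVarianceFloor ∧ S18_ClusteringFloorStrongCoupling ∧ S19_ClusteringFloorIffCrossCut

/-- The extended theory conjunction holds. -/
theorem TheoryStatementS19_holds : TheoryStatementS19 :=
  ⟨TheoryStatementS14_holds, S15_U1CrossCutFloorAllR_holds, S16_SUNUNCrossCutFloorAllR_holds,
    S17_DefectVarianceFloor_holds, S18_ClusteringFloorStrongCoupling_holds,
    S19_ClusteringFloorIffCrossCut_holds⟩

end Summit.Ventures.LatticeQCDFlow

end
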